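import Literature.NumberTheory.Automorphic.MeyerHplusStructure
import Literature.NumberTheory.Automorphic.IdelicThetaSumIntegrability
import HarnessLib

/-!
# Linearity in the test function of the `T`-free coefficients of Tate's truncated zeta integral

Topic `NumberTheory/Automorphic`; namespace `Literature.NumberTheory.Automorphic`. THEOREMS ONLY
(no definition, no instance, no notation, no named fact, no `sorry`). In the zeta-free form of
Rogawski's Lemma 7.1.1 [Rogawski1990, §7.1] (`TateTruncatedZetaIntegral`),
`I_T(f) = V log T · 𝔉f(0) + A(f) + Â(f) − V f(0)` with
`A(f) = ∫_{𝓕 ∩ {‖x‖ ≥ 1}} Σf(x) ‖x‖ dν` and `Â(f) = ∫_{𝓕 ∩ {‖x‖ ≥ 1}} Σ(𝔉f)(x) dν`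
(`Σ = Meyer.ideleSum K`, `𝔉 = Meyer.adeleFourier K μ`), the two `T`-free coefficients are
`ℂ`-LINEAR in `f ∈ 𝒮(𝔸_K)` — the form in which print splits the constant term over a sum of
test functions ([Rogawski1990, Prop. 7.3.2], terms (b) and (e)). Linearity of `Σ` and `𝔉` on
`𝒮(𝔸_K)` is Meyer's [Meyer2005, Lemma 5.3–5.4] (`MeyerHplusStructure`); absolute convergence of
`A`, `Â` is `IdelicThetaSumIntegrability`.

* `setIntegral_ideleSum_mul_ideleNorm_add`, `setIntegral_ideleSum_mul_ideleNorm_smul` — `A`;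
* `setIntegral_ideleSum_adeleFourier_add`, `setIntegral_ideleSum_adeleFourier_smul` — `Â`.

Cell `hodgecm-mathlib`, ENGINE T1 LAW 5 row (L5-i) (B-p17 (g18) piece E ask (ii)). HC_CM is
proved only modulo the 7 printed citations until rung 0 closes — nothing here bears on a summit
statement.

## References
* [Rogawski1990] J. D. Rogawski, *Automorphic Representations of Unitary Groups in Three
  Variables*, Ann. of Math. Stud. 123 (1990), §7.1 Lemma 7.1.1; §7.3 Prop. 7.3.2.
* [Meyer2005] R. Meyer, *On a representation of the idele class group related to primes and zeros
  of L-functions*, Duke Math. J. 127 (2005), §5.3, Lemmas 5.3–5.4.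
-/

set_option autoImplicit false

noncomputable section

open MeasureTheory MeasureTheory.Measure NumberField IsDedekindDomain Set Filter
open scoped ENNReal NNReal
open Literature.NumberTheory.Automorphic.Meyer

namespace Literature.NumberTheory.Automorphic

variable {K : Type} [Field K] [NumberField K]
  [MeasurableSpace (GaloisRepresentations.ideleGroup K)] [BorelSpace (GaloisRepresentations.ideleGroup K)]
  (ν : Measure (GaloisRepresentations.ideleGroup K)) [ν.IsHaarMeasure]
  {𝓕 : Set (GaloisRepresentations.ideleGroup K)}

/-- **Additivity of `A(f) = ∫_{𝓕 ∩ {‖x‖≥1}} Σf(x)‖x‖ dν` in `f ∈ 𝒮(𝔸_K)`** (both sides converge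
absolutely). [cite: Rogawski1990, §7.1 Lemma 7.1.1] [cite: Meyer2005, Lemma 5.3] -/
theorem setIntegral_ideleSum_mul_ideleNorm_add (h𝓕 : IsIdeleClassDomain K 𝓕)
    {f g : AdeleRing (𝓞 K) K → ℂ} (hf : f ∈ schwartzBruhatAdele K) (hg : g ∈ schwartzBruhatAdele K) :
    ∫ x in {x | 1 ≤ (IdeleClassGroup.ideleNorm K x : ℝ)} ∩ 𝓕,
        ideleSum K (f + g) x * ((IdeleClassGroup.ideleNorm K x : ℝ) : ℂ) ∂ν =
      (∫ x in {x | 1 ≤ (IdeleClassGroup.ideleNorm K x : ℝ)} ∩ 𝓕,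
          ideleSum K f x * ((IdeleClassGroup.ideleNorm K x : ℝ) : ℂ) ∂ν) +
        ∫ x in {x | 1 ≤ (IdeleClassGroup.ideleNorm K x : ℝ)} ∩ 𝓕,
          ideleSum K g x * ((IdeleClassGroup.ideleNorm K x : ℝ) : ℂ) ∂ν := by
  have hpt : (fun x => ideleSum K (f + g) x * ((IdeleClassGroup.ideleNorm K x : ℝ) : ℂ)) =
      fun x => ideleSum K f x * ((IdeleClassGroup.ideleNorm K x : ℝ) : ℂ) +
        ideleSum K g x * ((IdeleClassGroup.ideleNorm K x : ℝ) : ℂ) :=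
    funext fun x => by rw [ideleSum_add_of_mem hf hg, add_mul]
  rw [hpt]
  exact integral_add (integrableOn_ideleSum_mul_ideleNorm ν h𝓕 hf)
    (integrableOn_ideleSum_mul_ideleNorm ν h𝓕 hg)

omit [BorelSpace (GaloisRepresentations.ideleGroup K)] [ν.IsHaarMeasure] in
/-- **Homogeneity of `A(f)`**: `A(c • f) = c · A(f)`. [cite: Rogawski1990, §7.1 Lemma 7.1.1]
[cite: Meyer2005, Lemma 5.3] -/
theorem setIntegral_ideleSum_mul_ideleNorm_smul (c : ℂ) (f : AdeleRing (𝓞 K) K → ℂ) :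
    ∫ x in {x | 1 ≤ (IdeleClassGroup.ideleNorm K x : ℝ)} ∩ 𝓕,
        ideleSum K (c • f) x * ((IdeleClassGroup.ideleNorm K x : ℝ) : ℂ) ∂ν =
      c * ∫ x in {x | 1 ≤ (IdeleClassGroup.ideleNorm K x : ℝ)} ∩ 𝓕,
        ideleSum K f x * ((IdeleClassGroup.ideleNorm K x : ℝ) : ℂ) ∂ν := by
  rw [← integral_const_mul]
  refine integral_congr_ae (ae_of_all _ fun x => ?_)
  show ideleSum K (c • f) x * _ = c * (ideleSum K f x * _)
  rw [ideleSum_smul, mul_assoc]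

variable [MeasurableSpace (AdeleRing (𝓞 K) K)] [BorelSpace (AdeleRing (𝓞 K) K)]
  (μ : Measure (AdeleRing (𝓞 K) K)) [μ.IsAddHaarMeasure]

/-- **Additivity of `Â(f) = ∫_{𝓕 ∩ {‖x‖≥1}} Σ(𝔉f)(x) dν` in `f ∈ 𝒮(𝔸_K)`** (`𝔉` is additive on
`𝒮(𝔸_K)` and lands in `𝒮(𝔸_K)`; both sides converge absolutely).
[cite: Rogawski1990, §7.1 Lemma 7.1.1] [cite: Meyer2005, Lemma 5.4] -/
theorem setIntegral_ideleSum_adeleFourier_add (h𝓕 : IsIdeleClassDomain K 𝓕)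
    {f g : AdeleRing (𝓞 K) K → ℂ} (hf : f ∈ schwartzBruhatAdele K) (hg : g ∈ schwartzBruhatAdele K) :
    ∫ x in {x | 1 ≤ (IdeleClassGroup.ideleNorm K x : ℝ)} ∩ 𝓕,
        ideleSum K (adeleFourier K μ (f + g)) x ∂ν =
      (∫ x in {x | 1 ≤ (IdeleClassGroup.ideleNorm K x : ℝ)} ∩ 𝓕,
          ideleSum K (adeleFourier K μ f) x ∂ν) +
        ∫ x in {x | 1 ≤ (IdeleClassGroup.ideleNorm K x : ℝ)} ∩ 𝓕,
          ideleSum K (adeleFourier K μ g) x ∂ν := by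
  have hFf := adeleFourier_mem_schwartzBruhatAdele μ hf
  have hFg := adeleFourier_mem_schwartzBruhatAdele μ hg
  have hpt : (fun x => ideleSum K (adeleFourier K μ (f + g)) x) =
      fun x => ideleSum K (adeleFourier K μ f) x + ideleSum K (adeleFourier K μ g) x :=
    funext fun x => by rw [adeleFourier_add_of_mem μ hf hg, ideleSum_add_of_mem hFf hFg]
  rw [hpt]
  exact integral_add (integrableOn_ideleSum ν h𝓕 hFf) (integrableOn_ideleSum ν h𝓕 hFg)

omit [BorelSpace (GaloisRepresentations.ideleGroup K)] [ν.IsHaarMeasure]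
  [BorelSpace (AdeleRing (𝓞 K) K)] [μ.IsAddHaarMeasure] in
/-- **Homogeneity of `Â(f)`**: `Â(c • f) = c · Â(f)`. [cite: Rogawski1990, §7.1 Lemma 7.1.1]
[cite: Meyer2005, Lemma 5.4] -/
theorem setIntegral_ideleSum_adeleFourier_smul (c : ℂ) (f : AdeleRing (𝓞 K) K → ℂ) :
    ∫ x in {x | 1 ≤ (IdeleClassGroup.ideleNorm K x : ℝ)} ∩ 𝓕,
        ideleSum K (adeleFourier K μ (c • f)) x ∂ν =
      c * ∫ x in {x | 1 ≤ (IdeleClassGroup.ideleNorm K x : ℝ)} ∩ 𝓕,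
        ideleSum K (adeleFourier K μ f) x ∂ν := by
  rw [← integral_const_mul]
  refine integral_congr_ae (ae_of_all _ fun x => ?_)
  show ideleSum K (adeleFourier K μ (c • f)) x = c * ideleSum K (adeleFourier K μ f) x
  rw [adeleFourier_smul, ideleSum_smul]

/-! ### The index-two character split (ED. 2)

For an index-two subgroup `H` (print: `F^* N(I_E) ≤ I_F`) with quadratic character `ω`
(`= 1` on `H`, `= −1` off `H`), integrating over `H` is averaging over the two characters of
`I_F ∕ H`: "equal to the sum over the characters `χ` of `F^*NI_E∖I_F` of `½ ∫ … χ(a) …`"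
[Rogawski1990, §7.2, proof of Prop. 7.2.2, p. 94]. Stated for an arbitrary measure space. -/

section IndexTwo

variable {α : Type*} [MeasurableSpace α] (m : Measure α) {s H : Set α}

/-- **Index-two character split**: if `ω = 1` on `H` and `ω = −1` off `H`, then for `g` integrable
on `s`, `∫_{s ∩ H} g = ½ ∫_s g + ½ ∫_s g·ω` (pointwise `1_H = (1 + ω)/2`).
[cite: Rogawski1990, §7.2 Prop. 7.2.2 (proof)] -/
theorem setIntegral_inter_eq_half_add_half_mul (hH : MeasurableSet H) (ω : α → ℂ)
    (hω₁ : ∀ x ∈ H, ω x = 1) (hω₂ : ∀ x ∉ H, ω x = -1) {g : α → ℂ} (hg : IntegrableOn g s m) :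
    ∫ x in s ∩ H, g x ∂m =
      (1 / 2 : ℂ) * ∫ x in s, g x ∂m + (1 / 2 : ℂ) * ∫ x in s, g x * ω x ∂m := by
  have hpt : (fun x => g x * ω x) = fun x => (2 : ℂ) * H.indicator g x - g x := by
    funext x
    by_cases hx : x ∈ H
    · rw [hω₁ x hx, indicator_of_mem hx]; ring
    · rw [hω₂ x hx, indicator_of_notMem hx]; ring
  have hind : IntegrableOn (H.indicator g) s m := by
    rw [IntegrableOn, integrable_indicator_iff hH, IntegrableOn, Measure.restrict_restrict hH]
    exact hg.mono_set inter_subset_right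
  rw [hpt, integral_sub (hind.const_mul 2) hg, integral_const_mul, setIntegral_indicator hH]
  ring

/-- The same with the character on the left: `∫_{s ∩ H} g = ½ ∫_s g + ½ ∫_s ω·g`.
[cite: Rogawski1990, §7.2 Prop. 7.2.2 (proof)] -/
theorem setIntegral_inter_eq_half_add_half_mul' (hH : MeasurableSet H) (ω : α → ℂ)
    (hω₁ : ∀ x ∈ H, ω x = 1) (hω₂ : ∀ x ∉ H, ω x = -1) {g : α → ℂ} (hg : IntegrableOn g s m) :
    ∫ x in s ∩ H, g x ∂m =
      (1 / 2 : ℂ) * ∫ x in s, g x ∂m + (1 / 2 : ℂ) * ∫ x in s, ω x * g x ∂m := by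
  rw [setIntegral_inter_eq_half_add_half_mul m hH ω hω₁ hω₂ hg]
  congr 2
  exact integral_congr_ae (ae_of_all _ fun x => mul_comm _ _)

end IndexTwo

end Literature.NumberTheory.Automorphic
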